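import Literature.NumberTheory.EllipticCurves.Kobayashi2003.SignedSelmerRankBoundProofs
import Literature.NumberTheory.EllipticCurves.Kobayashi2003.SignedSelmerDualUniquenessProofs
import Literature.NumberTheory.EllipticCurves.IwasawaEulerCharRankZeroAssemblyProofs
import Literature.NumberTheory.EllipticCurves.IwasawaSelmerControlKernelProofs
import Literature.NumberTheory.EllipticCurves.SelmerCorankControlProofs
import Literature.NumberTheory.EllipticCurves.LeadingTermPPartProofs
import HarnessLib

/-!
# Signed Selmer groups at the bottom layer: `ord_p #Sel_{p^∞}(E/K) ≤ ord_p f^ε(0)` from control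
# injectivity and the absence of finite `Λ`-submodules (cell `b2b-bsdres`, seat additive-p4, line V18)

HONEST FRAMING (cell `b2b-bsdres`, run/shared/lean/b2b/bsd-rank1-residual/, verbatim in every
file): the goal of the cell is to DELETE the COMBINATION-SHAPED residual classes of the
Birch–Swinnerton-Dyer formula for ALL analytic-rank `≤ 1` elliptic curves over `ℚ` — "full BSD
formula for every rank `≤ 1` curve in class `C`" assembled STRICTLY from published theorems — so
that the rank-`≤ 1` remainder becomes exactly the CONSTRUCTION-SHAPED classes, which are TYPED
(missing-input `Prop`s), NOT attempted. This is not "finishing BSD". Seat additive-p4 (research route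
on the construction-shaped additive classes X3/X4); no label moves; nothing is booked here.

Theorems only (no `def`, no `sorry`, no named fact). GENERIC algebra for line V18 (the X4 pairs
`(W, 3)` whose twist `V = W^{(−3)}` is good SUPERSINGULAR at `3` with `a₃(V) = 0`, over
`K = ℚ(ζ₃)`): over the ramified base `K_0 = ℚ(μ_p)` no exact `Γ`-Euler-characteristic formula for
Kobayashi's signed Selmer groups is in print (B. D. Kim 2013 Cor. 3.15 requires `p` UNRAMIFIED in
the base field), so the rank-`0` bound of line V18 uses only

* the INJECTIVITY half of control at the bottom layer — Kobayashi 2003, Lemma 9.1 ("The morphisms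
  `Sel^±(E/K_n) → Sel^±(E/K_∞)` are injective. Proof. … inflation-restriction … and the fact that
  `E(K_∞)_{p^∞} = 0`"), here for ANY number field `K`, ANY `ℤ_p`-extension `κ` with topological
  generator `γ` and either sign, from the tree's Greenberg Lemma 3.1 embedding
  `ker h_0 ↪ B/(γ−1)B` (`finite_ker_layerToInfty_and_card_le`) under `B = E(K_∞)[p^∞] = 0`, and
  `Sel^ε(E/K_0) = Sel_{p^∞}(E/K)` (`signedSelmerLayer_zero_eq`);
* Greenberg's Lemma 4.2 on the `X`-side (tree theorem
  `constantCoeff_charGenerator_mul_natCard_invariants`: `f(0)·#X[T] = u·#(X/TX)`), the Pontryagin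
  transfer `#(X/TX) = #(Sel^ε_∞)^γ` (`IsDualPair.natCard_coinvariants`) for the signed datum, and
  `X/TX` finite as soon as `f(0) ≠ 0` (`order_eq_toNat_lengthAt`, `card_coinvariants_of_lengthAt_eq_zero`);
* the hypothesis that `X^ε(E/K_∞)` has NO non-trivial finite `Λ`-submodule (for `K = ℚ(μ_p)`,
  `E/ℚ`, `a_p = 0`, sign `+`: Kitajima–Otsuki 2018 Main Thm. 1.3, the named fact of the sibling
  Literature file), which forces `X[T] = 0`.

Result (`SignedControlZero.padicValNat_card_selmerGroupPInfty_le`): for a signed Pontryagin-dual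
datum `D` of `Sel^ε(E/K_∞)` with `X^ε` finitely generated torsion, `char(X^ε) = (f)`, `f(0) ≠ 0`,
`E(K_∞)[p^∞] = 0` and no finite submodule: `Sel_{p^∞}(E/K)` is finite and
**`ord_p #Sel_{p^∞}(E/K) ≤ ord_p f(0)`**. This is the algebraic half of Greenberg's Thm. 4.1 /
B. D. Kim's Cor. 3.15 as an INEQUALITY, losing exactly the Tamagawa factor `∏_v c_v` and the local
index at `p` (which an exact formula would subtract) — the price of having no printed Euler
characteristic over a base in which `p` ramifies.

References: [Kobayashi2003] S. Kobayashi, Invent. Math. 152 (2003), Lemma 9.1 (p. 25), Def. 1.1 /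
2.1; [GreenbergLNM1716] R. Greenberg, LNM 1716 (1999), §3 Lemma 3.1 (p. 86), §4 Lemma 4.2 (p. 102);
[KitajimaOtsuki2018] T. Kitajima, R. Otsuki, Tokyo J. Math. 41 (2018), Main Thm. 1.3; [BDKim2013]
B. D. Kim, J. Aust. Math. Soc. 95 (2013), Cor. 3.15 (the exact formula this inequality replaces).
-/

noncomputable section

open scoped Classical

open WeierstrassCurve Literature.NumberTheory.EllipticCurves Literature.NumberTheory.GaloisRepresentations
  Literature.NumberTheory.EllipticCurves.IwasawaAlgebra Literature.NumberTheory.EllipticCurves.IwasawaDual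
  Literature.NumberTheory.EllipticCurves.Kobayashi2003 ZpExtension

universe u

namespace Summit.BirchSwinnertonDyer.Rank1Residual.Additive

namespace SignedControlZero

/-! ## §1 `Λ`-algebra: `f(0) ≠ 0` ⇒ `X[T]`, `X/TX` finite -/

section Algebra

variable (p : ℕ) [Fact p.Prime] (M : Type u) [AddCommGroup M] [Module (IwasawaAlgebra p) M]
  [Module.Finite (IwasawaAlgebra p) M]

/-- **`f(0) ≠ 0` ⇒ `X[T]` and `X/TX` are finite** for a finitely generated torsion `Λ`-module `X`
with `char(X) = (f)`: `ord_T f = ℓ_{(T)}(X)` (`order_eq_toNat_lengthAt`), so `ℓ_{(T)}(X) = 0`, and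
then `X[T]`, `X/TX` are finite (`card_coinvariants_of_lengthAt_eq_zero`). Greenberg, LNM 1716,
proof of Lemma 4.2 (p. 103: "`X/TX` is finite if and only if `f(0) ≠ 0`").
[cite: GreenbergLNM1716, §4 Lemma 4.2 (p. 102)] -/
theorem finite_invariants_coinvariants_of_constantCoeff_ne_zero
    (hM : Module.IsTorsion (IwasawaAlgebra p) M) (f : IwasawaAlgebra p)
    (hf : Module.charIdeal (IwasawaAlgebra p) M = Ideal.span {f})
    (h0 : PowerSeries.constantCoeff f ≠ 0) :
    Finite (invariants p M) ∧ Finite (coinvariants p M) := by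
  have hord : f.order = 0 := by
    have h := PowerSeries.order_le (φ := f) 0 (by rwa [PowerSeries.coeff_zero_eq_constantCoeff])
    exact nonpos_iff_eq_zero.mp (by exact_mod_cast h)
  have hlen := order_eq_toNat_lengthAt p (M := M) hM f hf (primeT p) rfl
  rw [hord] at hlen
  have hne : Module.lengthAt (IwasawaAlgebra p) M (primeT p) ≠ ⊤ :=
    IwasawaAlgebra.lengthAt_ne_top_of_isTorsion M hM (primeT p) (height_primeT p).le
  have hlen0 : Module.lengthAt (IwasawaAlgebra p) M (primeT p) = 0 := by
    have h' : (Module.lengthAt (IwasawaAlgebra p) M (primeT p)).toNat = 0 := by exact_mod_cast hlen.symm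
    rcases (ENat.toNat_eq_zero.mp h') with h | h
    · exact h
    · exact absurd h hne
  obtain ⟨h1, h2, -⟩ := card_coinvariants_of_lengthAt_eq_zero M hM hlen0
  exact ⟨h1, h2⟩

/-- **`X[T] = 0` and `#(X/TX) ∼ f(0)` when `X` has no non-trivial finite `Λ`-submodule** (and
`char(X) = (f)`, `f(0) ≠ 0`): `X[T]` is a finite `Λ`-submodule, hence trivial, and Greenberg's
Lemma 4.2 (`f(0) · #X[T] = u · #(X/TX)`) reads `f(0) = u · #(X/TX)`, `u ∈ ℤ_p^×`.
[cite: GreenbergLNM1716, §4 Lemma 4.2 (p. 102)] -/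
theorem exists_constantCoeff_eq_unit_mul_natCard_coinvariants
    (hM : Module.IsTorsion (IwasawaAlgebra p) M) (f : IwasawaAlgebra p)
    (hf : Module.charIdeal (IwasawaAlgebra p) M = Ideal.span {f})
    (h0 : PowerSeries.constantCoeff f ≠ 0)
    (hnf : ∀ N : Submodule (IwasawaAlgebra p) M, Finite N → N = ⊥) :
    Finite (coinvariants p M) ∧
      ∃ u : ℤ_[p]ˣ, PowerSeries.constantCoeff f = u * Nat.card (coinvariants p M) := by
  obtain ⟨hinv, hcoinv⟩ := finite_invariants_coinvariants_of_constantCoeff_ne_zero p M hM f hf h0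
  have hbot : invariants p M = ⊥ := hnf _ hinv
  have hcard1 : Nat.card (invariants p M) = 1 := by
    rw [hbot]; exact Nat.card_unique
  obtain ⟨u, hu⟩ := constantCoeff_charGenerator_mul_natCard_invariants p M hM f hf hcoinv
  refine ⟨hcoinv, u, ?_⟩
  rw [hcard1, Nat.cast_one, mul_one] at hu
  exact hu

end Algebra

/-! ## §2 The signed datum is a dual pair; control injectivity at the bottom layer -/

section Signed

variable {K : Type u} [Field K] [NumberField K] (W : WeierstrassCurve K) {p : ℕ} [Fact p.Prime]
  {κ : ZpExtension K p} {γ : Field.absoluteGaloisGroup K} {ε : ℤˣ}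

/-- Every signed Pontryagin-dual datum `D : SignedSelmerDualData W κ γ ε` is a dual pair for
`ψ = conj_γ − 1` on `Sel^ε(E/K_∞)` (`conjSignedSelmerInfty`): `toDual_T_smul`, `toDual_C_smul`, and
local nilpotence `isLocNil_conjSignedSelmerInfty_sub_one` for a topological generator `γ` — the
signed copy of the tree's `SelmerDualData.isDualPair`. [cite: Kobayashi2003, Def. 1.1 and Thm. 1.2 (the object only)] -/
theorem isDualPair (D : SignedSelmerDualData W κ γ ε) (hγ : κ.IsTopGenerator γ) :
    IwasawaDual.IsDualPair p (conjSignedSelmerInfty W κ ε γ - 1) D.toDual where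
  bijective := D.bijective
  T_smul x s := by
    rw [D.toDual_T_smul, IwasawaDual.End_sub_apply, AddMonoid.End.one_apply, map_sub]
    rfl
  C_smul c x s k hk := D.toDual_C_smul c x s k hk
  locNil := isLocNil_conjSignedSelmerInfty_sub_one W κ ε hγ

/-- Membership in `(Sel^ε_∞)^γ = ker(conj_γ − 1)`: `s` is fixed by `conj_γ`.
[cite: Kobayashi2003, Def. 1.1 (sentence following it, p. 2)] -/
theorem mem_endInvariants_conjSignedSelmerInfty_iff (s : signedSelmerInfty W κ ε) :
    s ∈ endInvariants (conjSignedSelmerInfty W κ ε γ - 1) ↔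
      W.conjH1 p κ.kerSubgroup γ (s : W.subgroupH1 p κ.kerSubgroup) = s := by
  rw [mem_endInvariants_iff, IwasawaDual.End_sub_apply, AddMonoid.End.one_apply, sub_eq_zero,
    ← coe_conjSignedSelmerInfty_apply]
  exact ⟨fun h ↦ congrArg (fun z : signedSelmerInfty W κ ε ↦ (z : W.subgroupH1 p κ.kerSubgroup)) h,
    fun h ↦ Subtype.ext h⟩

/-- **Kobayashi's Lemma 9.1 at `n = 0` with Greenberg's Lemma 3.1**: if
`B = E(K_∞)[p^∞] = E[p^∞]^{Gal(K̄/K_∞)}` is trivial, the restriction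
`h_0 : H¹(K_0, E[p^∞]) → H¹(K_∞, E[p^∞])` (`layerToInfty κ 0`) is injective — its kernel embeds in
`B/(γ − 1)B = 0` (`finite_ker_layerToInfty_and_card_le`). [cite: Kobayashi2003, Lemma 9.1 (p. 25)]
[cite: GreenbergLNM1716, §3 Lemma 3.1 (p. 86)] -/
theorem layerToInfty_zero_injective (hγ : κ.IsTopGenerator γ)
    (hB : FixedPoints.addSubgroup κ.kerSubgroup (W.geomPrimaryTorsion p) = ⊥) :
    Function.Injective (W.layerToInfty κ 0) := by
  haveI hsub : Subsingleton (FixedPoints.addSubgroup κ.kerSubgroup (W.geomPrimaryTorsion p)) := by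
    rw [hB]; infer_instance
  haveI hfinQ : Finite (FixedPoints.addSubgroup κ.kerSubgroup (geomPrimaryTorsion W p) ⧸
      (ResKernel.subOne κ.kerSubgroup (geomPrimaryTorsion W p) (γ ^ p ^ 0)).range) :=
    Finite.of_surjective _ (QuotientAddGroup.mk'_surjective _)
  have hcardQ : Nat.card (FixedPoints.addSubgroup κ.kerSubgroup (geomPrimaryTorsion W p) ⧸
      (ResKernel.subOne κ.kerSubgroup (geomPrimaryTorsion W p) (γ ^ p ^ 0)).range) ≤ 1 := by
    rw [Finite.card_le_one_iff_subsingleton]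
    refine ⟨fun a b ↦ ?_⟩
    obtain ⟨a, rfl⟩ := QuotientAddGroup.mk'_surjective _ a
    obtain ⟨b, rfl⟩ := QuotientAddGroup.mk'_surjective _ b
    rw [Subsingleton.elim a b]
  obtain ⟨hfin, hle⟩ := W.finite_ker_layerToInfty_and_card_le κ hγ 0
  haveI := hfin
  haveI : Subsingleton (W.layerToInfty κ 0).ker :=
    Finite.card_le_one_iff_subsingleton.mp (hle.trans hcardQ)
  rw [← AddMonoidHom.ker_eq_bot_iff]
  exact (W.layerToInfty κ 0).ker.eq_bot_of_subsingleton

/-- **`Sel_{p^∞}(E/K_0) ↪ (Sel^ε(E/K_∞))^γ`** when `E(K_∞)[p^∞] = 0`: the restriction `h_0` carries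
`Sel_{p^∞}(E/K_0) = Sel^ε(E/K_0)` (`signedSelmerLayer_zero_eq`) into `Sel^ε(E/K_∞)` (by definition of
the direct limit) and into the `Γ`-invariants (`range_layerToInfty_le_layerInvariants`), injectively
(`layerToInfty_zero_injective`); hence `#Sel_{p^∞}(E/K_0)` divides `#(Sel^ε_∞)^γ`.
[cite: Kobayashi2003, Lemma 9.1 (p. 25)] [cite: GreenbergLNM1716, §3 Lemma 3.1 (p. 86)] -/
theorem natCard_selmerLayer_zero_dvd_natCard_endInvariants (hγ : κ.IsTopGenerator γ)
    (hB : FixedPoints.addSubgroup κ.kerSubgroup (W.geomPrimaryTorsion p) = ⊥) :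
    Nat.card (W.selmerLayer κ 0) ∣
      Nat.card (endInvariants (conjSignedSelmerInfty W κ ε γ - 1)) := by
  -- the map `c ↦ h_0 c`
  have hmem : ∀ c : W.selmerLayer κ 0,
      W.layerToInfty κ 0 (c : W.subgroupH1 p (κ.layerSubgroup 0)) ∈ signedSelmerInfty W κ ε := by
    intro c
    refine map_layerToInfty_signedSelmerLayer_le W κ ε 0 ⟨c, ?_, rfl⟩
    rw [signedSelmerLayer_zero_eq]
    exact c.2
  have hfix : ∀ c : W.selmerLayer κ 0,
      (⟨W.layerToInfty κ 0 (c : W.subgroupH1 p (κ.layerSubgroup 0)), hmem c⟩ : signedSelmerInfty W κ ε) ∈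
        endInvariants (conjSignedSelmerInfty W κ ε γ - 1) := by
    intro c
    rw [mem_endInvariants_conjSignedSelmerInfty_iff]
    have hinv := W.range_layerToInfty_le_layerInvariants_holds κ 0
      ⟨(c : W.subgroupH1 p (κ.layerSubgroup 0)), rfl⟩
    rw [mem_layerInvariants_iff] at hinv
    exact hinv γ (by rw [ZpExtension.layerSubgroup_zero]; exact Subgroup.mem_top γ)
  let φ : W.selmerLayer κ 0 →+ endInvariants (conjSignedSelmerInfty W κ ε γ - 1) :=
    { toFun := fun c ↦ ⟨⟨W.layerToInfty κ 0 (c : W.subgroupH1 p (κ.layerSubgroup 0)), hmem c⟩, hfix c⟩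
      map_zero' := by
        apply Subtype.ext; apply Subtype.ext
        simp only [ZeroMemClass.coe_zero, map_zero]
      map_add' := fun a b ↦ by
        apply Subtype.ext; apply Subtype.ext
        simp only [AddSubgroup.coe_add, map_add] }
  have hφ : Function.Injective φ := by
    intro a b hab
    have h := congrArg (fun z : endInvariants (conjSignedSelmerInfty W κ ε γ - 1) ↦
      ((z : signedSelmerInfty W κ ε) : W.subgroupH1 p κ.kerSubgroup)) hab
    exact Subtype.ext (layerToInfty_zero_injective W hγ hB h)
  exact AddSubgroup.card_dvd_of_injective φ hφ

/-! ## §3 The bound `ord_p #Sel_{p^∞}(E/K) ≤ ord_p f^ε(0)` -/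

/-- **Line V18's control inequality.** Let `E/K` be an elliptic curve over a number field, `κ` a
`ℤ_p`-extension with topological generator `γ`, `ε` a sign, and `D` a Pontryagin-dual datum of
Kobayashi's `Sel^ε(E/K_∞)` whose module `X^ε` is finitely generated and `Λ`-torsion with
`char(X^ε) = (f)`. ASSUME `f(0) ≠ 0`, `E(K_∞)[p^∞] = 0`, and that `X^ε` has no non-trivial finite
`Λ`-submodule. THEN `Sel_{p^∞}(E/K)` is finite and **`ord_p #Sel_{p^∞}(E/K) ≤ ord_p f(0)`**:
`#Sel_{p^∞}(E/K) = #Sel_{p^∞}(E/K_0) ∣ #(Sel^ε_∞)^γ = #(X^ε/TX^ε)` and `f(0) = u · #(X^ε/TX^ε)`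
(`X^ε[T] = 0`). The INEQUALITY form of the rank-`0` Euler characteristic (Greenberg Thm. 4.1 / B. D.
Kim Cor. 3.15 would give `f(0) ∼ #Sel · ∏ c_v · (local index at p)`); it is what is available in
print over a base field in which `p` ramifies (line V18: `K = ℚ(μ₃)`).
[cite: Kobayashi2003, Lemma 9.1 (p. 25) and Thm. 9.3 (p. 26)] [cite: GreenbergLNM1716, §4 Lemma 4.2 (p. 102)] -/
theorem padicValNat_card_selmerGroupPInfty_le (hγ : κ.IsTopGenerator γ)
    (D : SignedSelmerDualData W κ γ ε) [Module.Finite (IwasawaAlgebra p) D.X]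
    (hX : Module.IsTorsion (IwasawaAlgebra p) D.X)
    (hB : FixedPoints.addSubgroup κ.kerSubgroup (W.geomPrimaryTorsion p) = ⊥)
    (hnf : ∀ N : Submodule (IwasawaAlgebra p) D.X, Finite N → N = ⊥)
    {f : IwasawaAlgebra p} (hf : D.charIdeal = Ideal.span {f})
    (h0 : PowerSeries.constantCoeff f ≠ 0) :
    Finite (W.selmerGroupPInfty p) ∧
      (padicValNat p (Nat.card (W.selmerGroupPInfty p)) : ℤ) ≤
        ((PowerSeries.constantCoeff f : ℤ_[p]) : ℚ_[p]).valuation := by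
  have hpair := isDualPair W D hγ
  obtain ⟨hcoinv, u, hu⟩ :=
    exists_constantCoeff_eq_unit_mul_natCard_coinvariants p D.X hX f hf h0 hnf
  -- `#(X/TX) = #(Sel^ε_∞)^γ`, finite
  have hcardS : Nat.card (coinvariants p D.X) =
      Nat.card (endInvariants (conjSignedSelmerInfty W κ ε γ - 1)) := hpair.natCard_coinvariants
  haveI hSfin : Finite (endInvariants (conjSignedSelmerInfty W κ ε γ - 1)) :=
    hpair.finite_coinvariants_iff.mp hcoinv
  -- `#Sel_{p^∞}(E/K) = #Sel(E/K_0) ∣ #(Sel^ε_∞)^γ`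
  have hdvd := natCard_selmerLayer_zero_dvd_natCard_endInvariants W (ε := ε) hγ hB
  rw [W.natCard_selmerLayer_zero_eq κ] at hdvd
  have hSpos : 0 < Nat.card (endInvariants (conjSignedSelmerInfty W κ ε γ - 1)) := Nat.card_pos
  have hSelne : Nat.card (W.selmerGroupPInfty p) ≠ 0 := fun h ↦ by
    rw [h] at hdvd
    exact hSpos.ne' (Nat.eq_zero_of_zero_dvd hdvd)
  have hSelfin : Finite (W.selmerGroupPInfty p) := Nat.finite_of_card_ne_zero hSelne
  refine ⟨hSelfin, ?_⟩
  -- valuations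
  have hle : padicValNat p (Nat.card (W.selmerGroupPInfty p)) ≤
      padicValNat p (Nat.card (endInvariants (conjSignedSelmerInfty W κ ε γ - 1))) := by
    rw [← padicValNat_dvd_iff_le hSpos.ne']
    exact (pow_padicValNat_dvd).trans hdvd
  have hval : ((PowerSeries.constantCoeff f : ℤ_[p]) : ℚ_[p]).valuation =
      (padicValNat p (Nat.card (endInvariants (conjSignedSelmerInfty W κ ε γ - 1))) : ℤ) := by
    have hcast : ((PowerSeries.constantCoeff f : ℤ_[p]) : ℚ_[p]) =
        ((u : ℤ_[p]) : ℚ_[p]) *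
          ((Nat.card (endInvariants (conjSignedSelmerInfty W κ ε γ - 1)) : ℕ) : ℚ_[p]) := by
      rw [hu, ← hcardS, PadicInt.coe_mul, PadicInt.coe_natCast]
    rw [hcast, Padic.valuation_mul (coe_units_ne_zero p u) (by exact_mod_cast hSpos.ne'),
      valuation_coe_units_eq_zero, zero_add, Padic.valuation_natCast]
  rw [hval]
  exact_mod_cast hle

end Signed

end SignedControlZero

end Summit.BirchSwinnertonDyer.Rank1Residual.Additive

end
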